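import Literature.AlgebraicGeometry.HodgeTheory.HodgeLociDichotomyOfHolomorphicFrames
import Mathlib.LinearAlgebra.Determinant
import HarnessLib

/-!
# Analytic moving frames: determinants and coordinates (Cramer), for Griffiths' frame hypothesis

Family `hodge`, layer `Literature/AlgebraicGeometry/HodgeTheory`; proof file (theorems only, no
definition, no named fact) of the unit `bku_finite_monodromyOrbit_of_isHodgeGenericIn`
(`HodgeGenericQbarDescent.lean`; Baldi–Klingler–Ullmo, Invent. Math. 235 (2024), §3.2).

`HodgeLociDichotomyOfHolomorphicFrames.lean` reduced that fact to a frame form of Griffiths'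
theorem: locally on `S(ℂ)`, a GRADED holomorphic family of bases of `Hᵏ(X_s; ℚ) ⊗ ℂ` adapted to the
whole transported Hodge flag, with holomorphic coordinate functions. The printed theorem (Voisin I,
Thm. 10.3: "the `F^p H^k(X_b) ⊂ H^k(X_b, ℂ) = H^k(X_0, ℂ)` are holomorphic sub-vector bundles") is a
statement about EACH `F^p` separately. This file proves the linear algebra and elementary several
complex variables in between, so that the remaining input of the unit is exactly the subbundle
statement (`bku_finite_monodromyOrbit_of_isHodgeGenericIn_of_holomorphicHodgeSubbundles`):

* `analyticOnNhd_basis_det`, `analyticOnNhd_matrix_det`, `analyticOnNhd_matrix_adjugate`,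
  `analyticOnNhd_matrix_inv` — determinants, adjugates and inverses of analytic matrix functions are
  analytic (Leibniz expansion, `A⁻¹ = (det A)⁻¹ • adj A`);
* `analyticOnNhd_basis_repr` — Cramer: the coordinates of a fixed vector in an analytically moving
  basis are analytic (so the coordinate clause of the frame hypothesis is automatic);
* `exists_gradedFrame_of_frames` — from analytic frames of the members `F z p` of an analytic family
  of flags and a graded basis adapted to the flag at one point `z₁`, an analytic family of bases,
  graded like the given one, adapted to the whole flag on a neighbourhood of `z₁` ("graph
  coordinates": normalise the frame of `F z p` by the inverse of its block of coordinates of degree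
  `≥ p`; the resulting matrix is block unipotent, `Matrix.BlockTriangular.det`);
* `exists_holomorphicFrame_of_subbundleFrames` — the geometric repackaging along the flat
  trivialisation (continuations of a reference admissible state; the frames for another admissible
  base state differ by a constant automorphism, `HodgeStructure.comapEquiv_comapEquiv`);
* `bku_finite_monodromyOrbit_of_isHodgeGenericIn_of_holomorphicHodgeSubbundles` — the fact from the
  subbundle form of Griffiths' theorem alone.

## References

* [VoisinHodgeI2002] C. Voisin, Hodge Theory and Complex Algebraic Geometry I, CUP (2002), §10.2.2,
  Thm. 10.3 (the Hodge subbundles `F^p 𝓗^k` are holomorphic), Thm. 10.9.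
* [Griffiths1968PeriodsII] P. Griffiths, Periods of integrals on algebraic manifolds II, Amer. J.
  Math. 90 (1968).
* [Deligne1972WeilK3] P. Deligne, La conjecture de Weil pour les surfaces K3, Invent. Math. 15
  (1972), Prop. 7.5.
* [BaldiKlinglerUllmo2024] G. Baldi, B. Klingler, E. Ullmo, On the distribution of the Hodge locus,
  Invent. Math. 235 (2024), §3.2.
-/

noncomputable section

open _root_.Topology _root_.Filter
open scoped TensorProduct

namespace Literature.AlgebraicGeometry.HodgeTheory

section HodgeTheory

section MovingFrame

variable {M : Type*} [AddCommGroup M] [Module ℂ M] {ι : Type*} [Fintype ι] [DecidableEq ι]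
  {E' : Type*} [NormedAddCommGroup E'] [NormedSpace ℂ E'] {D : Set E'}

/-- **The determinant of an analytic family of vectors is analytic**: if all coordinates
`z ↦ u.repr (f z j) i` in a fixed basis `u` are analytic on `D`, so is `z ↦ u.det (f z)` (Leibniz
expansion). [folklore] -/
theorem analyticOnNhd_basis_det (u : Module.Basis ι ℂ M) (f : E' → ι → M)
    (hf : ∀ i j, AnalyticOnNhd ℂ (fun z ↦ u.repr (f z j) i) D) :
    AnalyticOnNhd ℂ (fun z ↦ u.det (f z)) D := by
  have h : (fun z ↦ u.det (f z)) =
      fun z ↦ ∑ σ : Equiv.Perm ι, ((Equiv.Perm.sign σ : ℤ) : ℂ) * ∏ i, u.repr (f z i) (σ i) := by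
    funext z
    rw [Module.Basis.det_apply, Matrix.det_apply]
    refine Finset.sum_congr rfl fun σ _ ↦ ?_
    rw [Units.smul_def, zsmul_eq_mul]
    simp only [Module.Basis.toMatrix_apply]
  rw [h]
  refine Finset.analyticOnNhd_fun_sum _ fun σ _ ↦ analyticOnNhd_const.mul ?_
  exact Finset.analyticOnNhd_fun_prod _ fun i _ ↦ hf (σ i) i

/-- **Cramer: the coordinates of a fixed vector in an analytically moving basis are analytic.**
If `e z` is a basis of `M` for every `z` and the linear functionals `z ↦ φ (e z i)` of the basis
vectors are analytic on `D`, then for every `w ∈ M` and index `i` the coordinate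
`z ↦ (e z).repr w i` is analytic on `D` (a quotient of determinants with non-vanishing
denominator, `Module.Basis.det_smul_mk_coord_eq_det_update`). [folklore] -/
theorem analyticOnNhd_basis_repr (e : E' → Module.Basis ι ℂ M)
    (hol : ∀ (i : ι) (φ : Module.Dual ℂ M), AnalyticOnNhd ℂ (fun z ↦ φ (e z i)) D)
    (w : M) (i : ι) : AnalyticOnNhd ℂ (fun z ↦ (e z).repr w i) D := by
  intro z₀ hz₀
  -- reference basis `u = e z₀`; Cramer's rule with respect to `u`
  set u := e z₀ with hu
  have hcr : ∀ z, (e z).repr w i =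
      u.det (Function.update (⇑(e z)) i w) / u.det ⇑(e z) := by
    intro z
    have hne : u.det ⇑(e z) ≠ 0 := (u.isUnit_det (e z)).ne_zero
    have hmk : Module.Basis.mk (e z).linearIndependent (e z).span_eq.ge = e z :=
      Module.Basis.eq_of_apply_eq fun j ↦ by rw [Module.Basis.coe_mk]
    have h := LinearMap.congr_fun
      (u.det_smul_mk_coord_eq_det_update (e z).linearIndependent (e z).span_eq.ge i) w
    rw [hmk, LinearMap.smul_apply, smul_eq_mul, MultilinearMap.toLinearMap_apply,
      AlternatingMap.coe_multilinearMap, Module.Basis.coord_apply] at h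
    rw [eq_div_iff hne, mul_comm]
    exact h
  have hfun : (fun z ↦ (e z).repr w i) =
      fun z ↦ u.det (Function.update (⇑(e z)) i w) / u.det ⇑(e z) := funext hcr
  rw [hfun]
  have hnum : AnalyticOnNhd ℂ (fun z ↦ u.det (Function.update (⇑(e z)) i w)) D := by
    refine analyticOnNhd_basis_det u _ fun i' j ↦ ?_
    by_cases hj : j = i
    · subst hj
      simp only [Function.update_self]
      exact analyticOnNhd_const
    · simp only [Function.update_of_ne hj]
      exact hol j (u.coord i')
  have hden : AnalyticOnNhd ℂ (fun z ↦ u.det ⇑(e z)) D :=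
    analyticOnNhd_basis_det u _ fun i' j ↦ hol j (u.coord i')
  exact (hnum z₀ hz₀).div (hden z₀ hz₀) (u.isUnit_det (e z₀)).ne_zero

/-- **The determinant of an analytic matrix-valued function is analytic** (Leibniz expansion).
[folklore] -/
theorem analyticOnNhd_matrix_det {n : Type*} [Fintype n] [DecidableEq n]
    (A : E' → Matrix n n ℂ) (hA : ∀ i j, AnalyticOnNhd ℂ (fun z ↦ A z i j) D) :
    AnalyticOnNhd ℂ (fun z ↦ (A z).det) D := by
  have h : (fun z ↦ (A z).det) =
      fun z ↦ ∑ σ : Equiv.Perm n, ((Equiv.Perm.sign σ : ℤ) : ℂ) * ∏ i, A z (σ i) i := by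
    funext z
    rw [Matrix.det_apply]
    refine Finset.sum_congr rfl fun σ _ ↦ ?_
    rw [Units.smul_def, zsmul_eq_mul]
  rw [h]
  refine Finset.analyticOnNhd_fun_sum _ fun σ _ ↦ analyticOnNhd_const.mul ?_
  exact Finset.analyticOnNhd_fun_prod _ fun i _ ↦ hA (σ i) i

/-- The entries of the adjugate of an analytic matrix-valued function are analytic. [folklore] -/
theorem analyticOnNhd_matrix_adjugate {n : Type*} [Fintype n] [DecidableEq n]
    (A : E' → Matrix n n ℂ) (hA : ∀ i j, AnalyticOnNhd ℂ (fun z ↦ A z i j) D) (i j : n) :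
    AnalyticOnNhd ℂ (fun z ↦ (A z).adjugate i j) D := by
  simp only [Matrix.adjugate_apply]
  refine analyticOnNhd_matrix_det _ fun i' j' ↦ ?_
  by_cases h : i' = j
  · subst h
    simp only [Matrix.updateRow_self]
    exact analyticOnNhd_const
  · simp only [Matrix.updateRow_ne h]
    exact hA i' j'

/-- **The entries of the inverse of an analytic matrix-valued function are analytic where the
determinant does not vanish** (`A⁻¹ = (det A)⁻¹ • adjugate A`). [folklore] -/
theorem analyticOnNhd_matrix_inv {n : Type*} [Fintype n] [DecidableEq n]
    (A : E' → Matrix n n ℂ) (hA : ∀ i j, AnalyticOnNhd ℂ (fun z ↦ A z i j) D)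
    (hdet : ∀ z ∈ D, (A z).det ≠ 0) (i j : n) :
    AnalyticOnNhd ℂ (fun z ↦ (A z)⁻¹ i j) D := by
  have h : (fun z ↦ (A z)⁻¹ i j) = fun z ↦ ((A z).det)⁻¹ * (A z).adjugate i j := by
    funext z
    rw [Matrix.inv_def, Matrix.smul_apply, smul_eq_mul, Ring.inverse_eq_inv']
  rw [h]
  intro z hz
  exact ((analyticOnNhd_matrix_det A hA z hz).inv (hdet z hz)).mul
    (analyticOnNhd_matrix_adjugate A hA i j z hz)

end MovingFrame

/-! ### A graded frame adapted to an analytic flag from frames of its members -/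

section GradedFrame

variable {M : Type*} [AddCommGroup M] [Module ℂ M] [FiniteDimensional ℂ M]
  {S : Type*} [Fintype S] [DecidableEq S]
  {E' : Type*} [NormedAddCommGroup E'] [NormedSpace ℂ E'] {D : Set E'}

/-- **From holomorphic frames of the members of a flag to a holomorphic graded frame adapted to
the whole flag** (linear algebra behind "a filtration by holomorphic subbundles has, locally,
adapted holomorphic frames"). Let `F z` (`z ∈ D`, `D` open) be decreasing `ℤ`-filtrations of a
finite-dimensional `M`, `u` a basis of `M` graded by `deg` and adapted to `F z₁`
(`F z₁ p = span {u σ | p ≤ deg σ}`), and for every `p` let `v p i z` (`i < r p`) be a frame of `F z p`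
(linearly independent, spanning) depending analytically on `z ∈ D` (through all linear
functionals). Then on an open neighbourhood `D' ⊆ D` of `z₁` there is an analytic family of bases
`e z` of `M`, indexed and graded like `u`, adapted to `F z` for every `z ∈ D'`:
`F z p = span {e z σ | p ≤ deg σ}` for all `p`. Construction ("graph coordinates"): reindex the frame
of `F z p` by `{σ | p ≤ deg σ}` and normalise it by the inverse of its matrix of `u`-coordinates of
degree `≥ p` (invertible at `z₁`, hence nearby) so that the new frame vector labelled `σ` is
`u σ` plus terms of degree `< p`; take `e z σ` to be the vector labelled `σ` of the normalised frame
of `F z (deg σ)`. The matrix of `e z` in `u` is block unipotent for the grading, so `e z` is a basis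
(determinant `1`), `e z σ ∈ F z (deg σ)`, and dimension count gives adaptedness. [folklore] -/
theorem exists_gradedFrame_of_frames (u : Module.Basis S ℂ M) (deg : S → ℤ)
    (hD : IsOpen D) {z₁ : E'} (hz₁ : z₁ ∈ D)
    (F : E' → ℤ → Submodule ℂ M) (hanti : ∀ z ∈ D, Antitone (F z))
    (hu : ∀ p, F z₁ p = Submodule.span ℂ (u '' {σ | p ≤ deg σ}))
    (r : ℤ → ℕ) (v : ∀ p : ℤ, Fin (r p) → E' → M)
    (hvF : ∀ z ∈ D, ∀ p, F z p = Submodule.span ℂ (Set.range fun i ↦ v p i z))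
    (hvli : ∀ z ∈ D, ∀ p, LinearIndependent ℂ (fun i ↦ v p i z))
    (hvhol : ∀ p i (φ : Module.Dual ℂ M), AnalyticOnNhd ℂ (fun z ↦ φ (v p i z)) D) :
    ∃ D' : Set E', IsOpen D' ∧ z₁ ∈ D' ∧ D' ⊆ D ∧ ∃ e : E' → Module.Basis S ℂ M,
      (∀ z ∈ D', ∀ p, F z p = Submodule.span ℂ (e z '' {σ | p ≤ deg σ})) ∧
      (∀ σ (φ : Module.Dual ℂ M), AnalyticOnNhd ℂ (fun z ↦ φ (e z σ)) D') := by
  classical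
  -- (1) cardinalities: `r p = #{σ | p ≤ deg σ}`; reindex the frames
  have hcard : ∀ p, Fintype.card {σ // p ≤ deg σ} = r p := by
    intro p
    have h1 : Module.finrank ℂ (F z₁ p) = r p := by
      rw [hvF z₁ hz₁ p, finrank_span_eq_card (hvli z₁ hz₁ p), Fintype.card_fin]
    have himg : u '' {σ | p ≤ deg σ} = Set.range (fun σ : {σ // p ≤ deg σ} ↦ u σ.1) := by
      ext m
      constructor
      · rintro ⟨σ, hσ, rfl⟩
        exact ⟨⟨σ, hσ⟩, rfl⟩
      · rintro ⟨⟨σ, hσ⟩, rfl⟩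
        exact ⟨σ, hσ, rfl⟩
    have h2 : Module.finrank ℂ (F z₁ p) = Fintype.card {σ // p ≤ deg σ} := by
      rw [hu p, himg]
      exact finrank_span_eq_card (b := fun σ : {σ // p ≤ deg σ} ↦ u σ.1)
        (u.linearIndependent.comp (fun σ : {σ // p ≤ deg σ} ↦ σ.1) Subtype.val_injective)
    exact h2.symm.trans h1
  let ε : ∀ p : ℤ, {σ // p ≤ deg σ} ≃ Fin (r p) := fun p ↦ Fintype.equivFinOfCardEq (hcard p)
  -- (2) the matrices of `u`-coordinates of degree `≥ p` of the reindexed frames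
  let A : ∀ p : ℤ, E' → Matrix {σ // p ≤ deg σ} {σ // p ≤ deg σ} ℂ :=
    fun p z ↦ Matrix.of fun τ σ ↦ u.repr (v p (ε p σ) z) τ.1
  have hAhol : ∀ p τ σ, AnalyticOnNhd ℂ (fun z ↦ A p z τ σ) D :=
    fun p τ σ ↦ hvhol p (ε p σ) (u.coord τ.1)
  have hA₁ : ∀ p, IsUnit (A p z₁).det := by
    intro p
    rw [← Matrix.isUnit_iff_isUnit_det, ← Matrix.linearIndependent_cols_iff_isUnit]
    let Φ : M →ₗ[ℂ] ({σ // p ≤ deg σ} → ℂ) := LinearMap.pi fun τ ↦ u.coord τ.1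
    have hcol : (A p z₁).col = Φ ∘ fun σ ↦ v p (ε p σ) z₁ := by
      funext σ
      ext τ
      simp only [Matrix.col_apply, Function.comp_apply]
      rfl
    rw [hcol]
    refine LinearIndependent.map ((hvli z₁ hz₁ p).comp (ε p) (ε p).injective) ?_
    rw [Submodule.disjoint_def]
    intro m hm hker
    have hm' : m ∈ F z₁ p := by
      rw [hvF z₁ hz₁ p]
      exact Submodule.span_mono (Set.range_comp_subset_range (ε p) fun i ↦ v p i z₁) hm
    rw [hu p, Module.Basis.mem_span_image] at hm'
    rw [LinearMap.mem_ker] at hker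
    rw [← u.repr.map_eq_zero_iff]
    ext τ
    rw [Finsupp.zero_apply]
    by_cases hτ : p ≤ deg τ
    · exact congr_fun hker ⟨τ, hτ⟩
    · have h : τ ∉ (u.repr m).support := fun h ↦ hτ (hm' h)
      simpa only [Finsupp.mem_support_iff, ne_eq, not_not] using h
  -- (3) the neighbourhood `D'` where the matrices of the relevant degrees are invertible
  let D' : Set E' := D ∩ {z | ∀ σ : S, (A (deg σ) z).det ≠ 0}
  have hD'D : D' ⊆ D := Set.inter_subset_left
  have hD'o : IsOpen D' := by
    have hD'eq : D' = D ∩ ⋂ σ : S, (D ∩ (fun z ↦ (A (deg σ) z).det) ⁻¹' {c | c ≠ 0}) := by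
      ext z
      simp only [D', Set.mem_inter_iff, Set.mem_setOf_eq, Set.mem_iInter, Set.mem_preimage]
      exact ⟨fun h ↦ ⟨h.1, fun σ ↦ ⟨h.1, h.2 σ⟩⟩, fun h ↦ ⟨h.1, fun σ ↦ (h.2 σ).2⟩⟩
    rw [hD'eq]
    refine hD.inter (isOpen_iInter_of_finite fun σ ↦ ?_)
    exact ((analyticOnNhd_matrix_det _ (hAhol (deg σ))).continuousOn).isOpen_inter_preimage hD
      isOpen_ne
  have hz₁D' : z₁ ∈ D' := ⟨hz₁, fun σ ↦ (hA₁ (deg σ)).ne_zero⟩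
  -- (4) the normalised frames and their `u`-coordinates of degree `≥ p`
  let vt : ∀ p : ℤ, {σ // p ≤ deg σ} → E' → M :=
    fun p σ z ↦ ∑ σ', (A p z)⁻¹ σ' σ • v p (ε p σ') z
  have hvt_mem : ∀ z ∈ D, ∀ p σ, vt p σ z ∈ F z p := by
    intro z hz p σ
    rw [hvF z hz p]
    exact Submodule.sum_mem _ fun σ' _ ↦
      Submodule.smul_mem _ _ (Submodule.subset_span ⟨ε p σ', rfl⟩)
  have hvt_repr : ∀ p z, IsUnit (A p z).det → ∀ τ σ : {σ // p ≤ deg σ},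
      u.repr (vt p σ z) τ.1 = if τ = σ then 1 else 0 := by
    intro p z hz τ σ
    have h : u.repr (vt p σ z) τ.1 = ∑ σ', A p z τ σ' * (A p z)⁻¹ σ' σ := by
      simp only [vt, map_sum, map_smul, Finsupp.coe_finsetSum, Finsupp.coe_smul, Finset.sum_apply,
        Pi.smul_apply, smul_eq_mul]
      exact Finset.sum_congr rfl fun σ' _ ↦ mul_comm _ _
    rw [h, ← Matrix.mul_apply, Matrix.mul_nonsing_inv _ hz, Matrix.one_apply]
  -- (5) the frame: the vector labelled `σ` of the normalised frame of degree `deg σ`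
  let ev : E' → S → M := fun z σ ↦ vt (deg σ) ⟨σ, le_rfl⟩ z
  have hev_repr : ∀ z ∈ D', ∀ τ σ : S, deg σ ≤ deg τ →
      u.repr (ev z σ) τ = if τ = σ then 1 else 0 := by
    intro z hz τ σ h
    have h' := hvt_repr (deg σ) z (isUnit_iff_ne_zero.2 (hz.2 σ)) ⟨τ, h⟩ ⟨σ, le_rfl⟩
    simp only [Subtype.mk.injEq] at h'
    exact h'
  have hdet1 : ∀ z ∈ D', u.det (ev z) = 1 := by
    intro z hz
    rw [Module.Basis.det_apply]
    have hC : ∀ τ σ : S, deg σ ≤ deg τ → u.toMatrix (ev z) τ σ = if τ = σ then 1 else 0 :=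
      fun τ σ h ↦ by rw [Module.Basis.toMatrix_apply, hev_repr z hz τ σ h]
    have hBT : (u.toMatrix (ev z)).BlockTriangular deg := by
      intro τ σ hlt
      rw [hC τ σ hlt.le, if_neg]
      rintro rfl
      exact lt_irrefl _ hlt
    rw [hBT.det]
    refine Finset.prod_eq_one fun a _ ↦ ?_
    have hblock : (u.toMatrix (ev z)).toSquareBlock deg a = 1 := by
      ext ⟨τ, hτ⟩ ⟨σ, hσ⟩
      rw [Matrix.toSquareBlock_def, Matrix.of_apply, hC τ σ (by rw [hτ, hσ]), Matrix.one_apply]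
      simp only [Subtype.mk.injEq]
    rw [hblock, Matrix.det_one]
  have hbasis : ∀ z ∈ D', LinearIndependent ℂ (ev z) ∧ Submodule.span ℂ (Set.range (ev z)) = ⊤ :=
    fun z hz ↦ (Module.Basis.is_basis_iff_det u).2 (by rw [hdet1 z hz]; exact isUnit_one)
  -- (6) analyticity of the frame vectors on `D'`
  have hev_hol : ∀ σ (φ : Module.Dual ℂ M), AnalyticOnNhd ℂ (fun z ↦ φ (ev z σ)) D' := by
    intro σ φ
    have hform : (fun z ↦ φ (ev z σ)) = fun z ↦
        ∑ σ', (A (deg σ) z)⁻¹ σ' ⟨σ, le_rfl⟩ * φ (v (deg σ) (ε (deg σ) σ') z) := by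
      funext z
      simp only [ev, vt, map_sum, map_smul, smul_eq_mul]
    rw [hform]
    refine Finset.analyticOnNhd_fun_sum _ fun σ' _ ↦ ?_
    exact (analyticOnNhd_matrix_inv (A (deg σ)) (fun i j ↦ (hAhol (deg σ) i j).mono hD'D)
      (fun z hz ↦ hz.2 σ) σ' ⟨σ, le_rfl⟩).mul ((hvhol _ _ φ).mono hD'D)
  -- (7) the bases and adaptedness
  refine ⟨D', hD'o, hz₁D', hD'D,
    fun z ↦ if h : z ∈ D' then Module.Basis.mk (hbasis z h).1 (hbasis z h).2.ge else u, ?_, ?_⟩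
  · intro z hz p
    simp only [dif_pos hz, Module.Basis.coe_mk]
    symm
    apply Submodule.eq_of_le_of_finrank_eq
    · rw [Submodule.span_le]
      rintro _ ⟨σ, hσ, rfl⟩
      exact hanti z (hD'D hz) hσ (hvt_mem z (hD'D hz) (deg σ) _)
    · have himg : ev z '' {σ | p ≤ deg σ} = Set.range (fun σ : {σ // p ≤ deg σ} ↦ ev z σ.1) := by
        ext m
        constructor
        · rintro ⟨σ, hσ, rfl⟩
          exact ⟨⟨σ, hσ⟩, rfl⟩
        · rintro ⟨⟨σ, hσ⟩, rfl⟩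
          exact ⟨σ, hσ, rfl⟩
      rw [himg, finrank_span_eq_card (b := fun σ : {σ // p ≤ deg σ} ↦ ev z σ.1)
        ((hbasis z hz).1.comp (fun σ : {σ // p ≤ deg σ} ↦ σ.1) Subtype.val_injective),
        hcard p, hvF z (hD'D hz) p, finrank_span_eq_card (hvli z (hD'D hz) p), Fintype.card_fin]
  · intro σ φ z hz
    have hev : (fun z ↦ φ (ev z σ)) =ᶠ[𝓝 z] fun z ↦
        φ ((if h : z ∈ D' then Module.Basis.mk (hbasis z h).1 (hbasis z h).2.ge else u) σ) := by
      filter_upwards [hD'o.mem_nhds hz] with z' hz'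
      simp only [dif_pos hz', Module.Basis.coe_mk]
    exact (hev_hol σ φ z hz).congr hev

end GradedFrame

/-! ### From frames of the Hodge subbundles to Griffiths' frame hypothesis -/

section Subbundles

open CategoryTheory
open Literature.AlgebraicTopology.SingularHomology Literature.AlgebraicGeometry.Motives

variable {𝒳 S : SchemeOver ℂ} (f : 𝒳 ⟶ S) (k : ℕ) {U : Set (ComplexPoints S)}
  (hU : IsCohomologicallyLocallyTrivialOn f U)

/-- **Holomorphic graded frames adapted to the transported Hodge filtrations, from holomorphic
frames of each Hodge subbundle** — the passage from "each `F^p` is a holomorphic subbundle of the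
flat bundle" (Voisin I, Thm. 10.3, read in a flat trivialisation: over a path-connected open `W₀`
inside a chart `ψ`, for a reference admissible state `(t₁, T₁)` and every `p`, a holomorphic frame
`w p i` spanning `F^p (T^* H_t)` along the continuations `T` of `T₁` inside `W₀`) to the frame
hypothesis of `bku_finite_monodromyOrbit_of_isHodgeGenericIn_of_holomorphicHodgeFrames` on a smaller
path-connected open `W ∋ t₁`: for EVERY admissible base state `(x, Tx)` with `x ∈ W`, a graded
holomorphic family of bases adapted to the whole flag along the continuations of `Tx` inside `W`,
with holomorphic coordinate functions. Proof: `exists_gradedFrame_of_frames` at `ψ t₁` (graded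
basis at `t₁` from the Hodge decomposition, `exists_basis_F_eq_span`), `W` the path component of
`t₁` in the good set, the frames for `(x, Tx)` being the translates of the reference frame by the
constant automorphism `g = Tx ∘ (T₁ continued to x)⁻¹` (`comapEquiv_comapEquiv`,
`comap_span_basis_image`), coordinates by Cramer (`analyticOnNhd_basis_repr`). [folklore] -/
theorem exists_holomorphicFrame_of_subbundleFrames [HodgeTensorFacts.{0, 0}]
    [LocallyPathConnectedSpace U] (s : U)
    [Module.Finite ℚ (singularCohomology ℚ ℚ (ComplexPoints (fiberOver f s.1)) k)]
    (hrat : ∀ (x y : U) (γ : Path.Homotopic.Quotient x y) (α : complexBetti (fiberOver f x.1) k),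
      IsRationalClass α → IsRationalClass (transportFun f k hU γ α))
    {n₀ : ℤ} (H : ∀ t : U, HodgeStructure (singularCohomology ℚ ℚ (ComplexPoints (fiberOver f t.1)) k) n₀)
    {W₀ : Set U} (hW₀o : IsOpen W₀) (hW₀pc : IsPathConnected W₀)
    {d : ℕ} (ψ : OpenPartialHomeomorph U (Fin d → ℂ)) (hW₀ψ : W₀ ⊆ ψ.source)
    {t₁ : U} (ht₁ : t₁ ∈ W₀)
    {T₁ : singularCohomology ℚ ℚ (ComplexPoints (fiberOver f s.1)) k ≃ₗ[ℚ]
      singularCohomology ℚ ℚ (ComplexPoints (fiberOver f t₁.1)) k}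
    (hT₁ : ∃ δ₁ : Path.Homotopic.Quotient s t₁,
      ∀ v, ofRatClass _ k (T₁ v) = transportFun f k hU δ₁ (ofRatClass _ k v))
    (r : ℤ → ℕ)
    (w : ∀ p : ℤ, Fin (r p) → U → ℂ ⊗[ℚ] singularCohomology ℚ ℚ (ComplexPoints (fiberOver f s.1)) k)
    (hw : ∀ (p : ℤ), ∀ t ∈ W₀, ∀ (ε : Path t₁ t), (∀ r', ε r' ∈ W₀) →
      ∀ (T : singularCohomology ℚ ℚ (ComplexPoints (fiberOver f s.1)) k ≃ₗ[ℚ]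
        singularCohomology ℚ ℚ (ComplexPoints (fiberOver f t.1)) k),
      (∀ v, ofRatClass _ k (T v) = transportFun f k hU ⟦ε⟧ (ofRatClass _ k (T₁ v))) →
      LinearIndependent ℂ (fun i ↦ w p i t) ∧
        ((H t).comapEquiv T).F p = Submodule.span ℂ (Set.range fun i ↦ w p i t))
    (hwhol : ∀ (p : ℤ) (i : Fin (r p))
      (φ : Module.Dual ℂ (ℂ ⊗[ℚ] singularCohomology ℚ ℚ (ComplexPoints (fiberOver f s.1)) k)),
      AnalyticOnNhd ℂ (fun z ↦ φ (w p i (ψ.symm z))) (ψ '' W₀)) :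
    ∃ W : Set U, IsOpen W ∧ t₁ ∈ W ∧ W ⊆ W₀ ∧ IsPathConnected W ∧
      ∀ (x : U), x ∈ W →
        ∀ (Tx : singularCohomology ℚ ℚ (ComplexPoints (fiberOver f s.1)) k ≃ₗ[ℚ]
          singularCohomology ℚ ℚ (ComplexPoints (fiberOver f x.1)) k),
        (∃ δ : Path.Homotopic.Quotient s x,
          ∀ v, ofRatClass _ k (Tx v) = transportFun f k hU δ (ofRatClass _ k v)) →
        ∃ (N' : ℕ) (deg : Fin N' → ℤ)
          (e : U → Module.Basis (Fin N') ℂ (ℂ ⊗[ℚ] singularCohomology ℚ ℚ (ComplexPoints (fiberOver f s.1)) k)),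
          (∀ t ∈ W, ∀ (ε : Path x t), (∀ r', ε r' ∈ W) →
            ∀ (T : singularCohomology ℚ ℚ (ComplexPoints (fiberOver f s.1)) k ≃ₗ[ℚ]
              singularCohomology ℚ ℚ (ComplexPoints (fiberOver f t.1)) k),
            (∀ v, ofRatClass _ k (T v) = transportFun f k hU ⟦ε⟧ (ofRatClass _ k (Tx v))) →
            ∀ p : ℤ, ((H t).comapEquiv T).F p = Submodule.span ℂ (e t '' {σ | p ≤ deg σ})) ∧
          (∀ (σ : Fin N')
            (φ : Module.Dual ℂ (ℂ ⊗[ℚ] singularCohomology ℚ ℚ (ComplexPoints (fiberOver f s.1)) k)),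
            AnalyticOnNhd ℂ (fun z ↦ φ (e (ψ.symm z) σ)) (ψ '' W)) ∧
          (∀ (σ : Fin N') (v : ℂ ⊗[ℚ] singularCohomology ℚ ℚ (ComplexPoints (fiberOver f s.1)) k),
            AnalyticOnNhd ℂ (fun z ↦ (e (ψ.symm z)).repr v σ) (ψ '' W)) := by
  classical
  obtain ⟨δ₁, hδ₁⟩ := hT₁
  -- continuations of `T₁` inside `W₀` exist at every point of `W₀`
  have hex : ∀ t ∈ W₀, ∀ (ε : Path t₁ t), (∀ r', ε r' ∈ W₀) →
      ∃ T : singularCohomology ℚ ℚ (ComplexPoints (fiberOver f s.1)) k ≃ₗ[ℚ]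
        singularCohomology ℚ ℚ (ComplexPoints (fiberOver f t.1)) k,
      ∀ v, ofRatClass _ k (T v) = transportFun f k hU ⟦ε⟧ (ofRatClass _ k (T₁ v)) := by
    intro t _ ε _
    obtain ⟨T, hT⟩ := exists_ratTransport f k hU hrat (δ₁.trans ⟦ε⟧)
    exact ⟨T, fun v ↦ by rw [hT, transportFun_trans, hδ₁]⟩
  -- the flag in the chart: `F z p` = span of the frame at `ψ.symm z`
  obtain ⟨F, hF⟩ : ∃ F : (Fin d → ℂ) → ℤ →
      Submodule ℂ (ℂ ⊗[ℚ] singularCohomology ℚ ℚ (ComplexPoints (fiberOver f s.1)) k),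
      ∀ z p, F z p = Submodule.span ℂ (Set.range fun i ↦ w p i (ψ.symm z)) := ⟨_, fun _ _ ↦ rfl⟩
  have hmemW₀ : ∀ z ∈ ψ '' W₀, ψ.symm z ∈ W₀ := by
    rintro _ ⟨t, ht, rfl⟩
    rwa [ψ.left_inv (hW₀ψ ht)]
  -- at a point of `W₀`, the flag is the transported Hodge filtration, for any continuation of `T₁`
  have hFH : ∀ t ∈ W₀, ∀ (ε : Path t₁ t), (∀ r', ε r' ∈ W₀) →
      ∀ (T : singularCohomology ℚ ℚ (ComplexPoints (fiberOver f s.1)) k ≃ₗ[ℚ]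
        singularCohomology ℚ ℚ (ComplexPoints (fiberOver f t.1)) k),
      (∀ v, ofRatClass _ k (T v) = transportFun f k hU ⟦ε⟧ (ofRatClass _ k (T₁ v))) →
      ∀ p, F (ψ t) p = ((H t).comapEquiv T).F p := by
    intro t ht ε hε T hT p
    rw [hF, ψ.left_inv (hW₀ψ ht), (hw p t ht ε hε T hT).2]
  have hanti : ∀ z ∈ ψ '' W₀, Antitone (F z) := by
    rintro _ ⟨t, ht, rfl⟩
    have hj : JoinedIn W₀ t₁ t := hW₀pc.joinedIn t₁ ht₁ t ht
    obtain ⟨T, hT⟩ := hex t ht hj.somePath hj.somePath_mem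
    intro p q hpq
    rw [hFH t ht hj.somePath hj.somePath_mem T hT, hFH t ht hj.somePath hj.somePath_mem T hT]
    exact ((H t).comapEquiv T).antitone_F hpq
  -- graded basis at the reference point
  obtain ⟨Sι, deg, u, hu, -⟩ := HodgeStructure.exists_basis_F_eq_span ((H t₁).comapEquiv T₁)
  have hT₁refl : ∀ v, ofRatClass _ k (T₁ v) =
      transportFun f k hU ⟦Path.refl t₁⟧ (ofRatClass _ k (T₁ v)) := fun v ↦ by
    rw [show (⟦Path.refl t₁⟧ : Path.Homotopic.Quotient t₁ t₁) = Path.Homotopic.Quotient.refl t₁ from rfl,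
      transportFun_refl]
  have hu' : ∀ p, F (ψ t₁) p = Submodule.span ℂ (u '' {σ | p ≤ deg σ}) := fun p ↦ by
    rw [hFH t₁ ht₁ (Path.refl t₁) (fun _ ↦ ht₁) T₁ hT₁refl, hu]
  -- the graded frame near `ψ t₁`
  haveI : Finite Sι := Module.Finite.finite_basis u
  haveI : Fintype Sι := Fintype.ofFinite Sι
  have hDo : IsOpen (ψ '' W₀) := (ψ.isOpen_image_iff_of_subset_source hW₀ψ).2 hW₀o
  obtain ⟨D', hD'o, hz₁, hD'D, e₀, he₀F, he₀hol⟩ := exists_gradedFrame_of_frames u deg hDo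
    (Set.mem_image_of_mem ψ ht₁) F hanti hu' r (fun p i z ↦ w p i (ψ.symm z))
    (fun z _ p ↦ hF z p)
    (fun z hz p ↦ by
      obtain ⟨t, ht, rfl⟩ := hz
      have hj : JoinedIn W₀ t₁ t := hW₀pc.joinedIn t₁ ht₁ t ht
      obtain ⟨T, hT⟩ := hex t ht hj.somePath hj.somePath_mem
      rw [ψ.left_inv (hW₀ψ ht)]
      exact (hw p t ht hj.somePath hj.somePath_mem T hT).1)
    hwhol
  -- the neighbourhood `W`: the path component of `t₁` in `{t ∈ W₀ | ψ t ∈ D'}`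
  have hGo : IsOpen (W₀ ∩ ψ ⁻¹' D') := by
    have h := ψ.continuousOn.isOpen_inter_preimage ψ.open_source hD'o
    have hEq : W₀ ∩ ψ ⁻¹' D' = W₀ ∩ (ψ.source ∩ ψ ⁻¹' D') := by
      ext t
      simp only [Set.mem_inter_iff, Set.mem_preimage]
      exact ⟨fun ht ↦ ⟨ht.1, hW₀ψ ht.1, ht.2⟩, fun ht ↦ ⟨ht.1, ht.2.2⟩⟩
    rw [hEq]
    exact hW₀o.inter h
  have ht₁G : t₁ ∈ W₀ ∩ ψ ⁻¹' D' := ⟨ht₁, hz₁⟩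
  refine ⟨pathComponentIn (W₀ ∩ ψ ⁻¹' D') t₁, hGo.pathComponentIn t₁, mem_pathComponentIn_self ht₁G,
    pathComponentIn_subset.trans Set.inter_subset_left, isPathConnected_pathComponentIn ht₁G, ?_⟩
  set W := pathComponentIn (W₀ ∩ ψ ⁻¹' D') t₁ with hWdef
  have hWW₀ : W ⊆ W₀ := pathComponentIn_subset.trans Set.inter_subset_left
  have hWD' : ∀ t ∈ W, ψ t ∈ D' := fun t ht ↦ (pathComponentIn_subset ht).2
  have hWpc : IsPathConnected W := isPathConnected_pathComponentIn ht₁G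
  have hWo' : IsOpen (ψ '' W) := (ψ.isOpen_image_iff_of_subset_source (hWW₀.trans hW₀ψ)).2
    (hGo.pathComponentIn t₁)
  have hWimD' : ψ '' W ⊆ D' := by
    rintro _ ⟨t, ht, rfl⟩
    exact hWD' t ht
  intro x hx Tx hTx
  -- the reference continuation of `T₁` to `x` inside `W`, and the constant comparison `g`
  have hj₁ : JoinedIn W t₁ x := hWpc.joinedIn t₁ (mem_pathComponentIn_self ht₁G) x hx
  set ε₁ : Path t₁ x := hj₁.somePath with hε₁
  have hε₁W : ∀ r', ε₁ r' ∈ W := hj₁.somePath_mem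
  obtain ⟨Tx₁, hTx₁⟩ := hex x (hWW₀ hx) ε₁ (fun r' ↦ hWW₀ (hε₁W r'))
  set g : singularCohomology ℚ ℚ (ComplexPoints (fiberOver f s.1)) k ≃ₗ[ℚ]
      singularCohomology ℚ ℚ (ComplexPoints (fiberOver f s.1)) k := Tx.trans Tx₁.symm with hg
  set gC := g.baseChange ℚ ℂ (singularCohomology ℚ ℚ (ComplexPoints (fiberOver f s.1)) k)
    (singularCohomology ℚ ℚ (ComplexPoints (fiberOver f s.1)) k) with hgC
  -- every continuation `T` of `Tx` inside `W` is `T' ∘ g` for a continuation `T'` of `T₁` inside `W`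
  have hcomp : ∀ t ∈ W, ∀ (ε : Path x t), (∀ r', ε r' ∈ W) →
      ∀ (T : singularCohomology ℚ ℚ (ComplexPoints (fiberOver f s.1)) k ≃ₗ[ℚ]
        singularCohomology ℚ ℚ (ComplexPoints (fiberOver f t.1)) k),
      (∀ v, ofRatClass _ k (T v) = transportFun f k hU ⟦ε⟧ (ofRatClass _ k (Tx v))) →
      ∃ (T' : singularCohomology ℚ ℚ (ComplexPoints (fiberOver f s.1)) k ≃ₗ[ℚ]
        singularCohomology ℚ ℚ (ComplexPoints (fiberOver f t.1)) k),
        (∀ v, ofRatClass _ k (T' v) = transportFun f k hU ⟦ε₁.trans ε⟧ (ofRatClass _ k (T₁ v))) ∧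
        T = g.trans T' := by
    intro t ht ε hε T hT
    obtain ⟨T', hT'⟩ := hex t (hWW₀ ht) (ε₁.trans ε)
      (AlgebraicTopology.FundamentalGroup.VanKampen.trans_mem (p := ε₁) (q := ε)
        (fun r' ↦ hWW₀ (hε₁W r')) fun r' ↦ hWW₀ (hε r'))
    refine ⟨T', hT', LinearEquiv.ext fun v ↦ ?_⟩
    apply ofRatClass_injective
    rw [LinearEquiv.trans_apply, hT' (g v), transportFun_mk_trans f k hU ε₁ ε, ← hTx₁ (g v), hT v]
    simp only [hg, LinearEquiv.trans_apply, LinearEquiv.apply_symm_apply]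
  -- the frame for `(x, Tx)`: the reference frame translated by `g⁻¹`, reindexed by `Fin N'`
  set eS := Fintype.equivFin Sι with heS
  refine ⟨Fintype.card Sι, deg ∘ eS.symm, fun t ↦ ((e₀ (ψ t)).map gC.symm).reindex eS, ?_, ?_, ?_⟩
  · intro t ht ε hε T hT p
    obtain ⟨T', hT', rfl⟩ := hcomp t ht ε hε T hT
    have hεW₀ : ∀ r', (ε₁.trans ε) r' ∈ W₀ :=
      AlgebraicTopology.FundamentalGroup.VanKampen.trans_mem
        (fun r' ↦ hWW₀ (hε₁W r')) fun r' ↦ hWW₀ (hε r')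
    rw [← HodgeStructure.comapEquiv_comapEquiv, HodgeStructure.comapEquiv_F,
      ← hFH t (hWW₀ ht) (ε₁.trans ε) hεW₀ T' hT' p, he₀F (ψ t) (hWD' t ht) p,
      show g.toLinearMap.baseChange ℂ = (gC : _ →ₗ[ℂ] _) from rfl, comap_span_basis_image]
    congr 1
    ext m
    simp only [Set.mem_image, Set.mem_setOf_eq, Module.Basis.reindex_apply, Function.comp_apply]
    constructor
    · rintro ⟨σ, hσ, rfl⟩
      exact ⟨eS σ, by simpa using hσ, by simp⟩
    · rintro ⟨i, hi, rfl⟩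
      exact ⟨eS.symm i, hi, rfl⟩
  · intro σ φ
    have hEq : (ψ '' W).EqOn (fun z ↦ (φ ∘ₗ (gC.symm : _ →ₗ[ℂ] _)) (e₀ z (eS.symm σ)))
        (fun z ↦ φ ((((e₀ (ψ (ψ.symm z))).map gC.symm).reindex eS) σ)) := by
      rintro _ ⟨t, ht, rfl⟩
      simp only [ψ.left_inv (hWW₀.trans hW₀ψ ht), Module.Basis.reindex_apply, Module.Basis.map_apply,
        LinearMap.comp_apply, LinearEquiv.coe_coe]
    exact ((he₀hol (eS.symm σ) (φ ∘ₗ (gC.symm : _ →ₗ[ℂ] _))).mono hWimD').congr hWo' hEq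
  · intro σ v
    refine analyticOnNhd_basis_repr (fun z ↦ ((e₀ (ψ (ψ.symm z))).map gC.symm).reindex eS)
      (fun i φ ↦ ?_) v σ
    have hEq : (ψ '' W).EqOn (fun z ↦ (φ ∘ₗ (gC.symm : _ →ₗ[ℂ] _)) (e₀ z (eS.symm i)))
        (fun z ↦ φ ((((e₀ (ψ (ψ.symm z))).map gC.symm).reindex eS) i)) := by
      rintro _ ⟨t, ht, rfl⟩
      simp only [ψ.left_inv (hWW₀.trans hW₀ψ ht), Module.Basis.reindex_apply, Module.Basis.map_apply,
        LinearMap.comp_apply, LinearEquiv.coe_coe]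
    exact ((he₀hol (eS.symm i) (φ ∘ₗ (gC.symm : _ →ₗ[ℂ] _))).mono hWimD').congr hWo' hEq

/-- **`bku_finite_monodromyOrbit_of_isHodgeGenericIn` from Griffiths' theorem in subbundle form**
("the Hodge bundles `F^p 𝓗^k` are holomorphic subbundles of the flat bundle `𝓗^k`", Voisin I,
Thm. 10.3; Griffiths 1968), stated on the tree's real carriers in a flat trivialisation: for a smooth
projective family `f` over a smooth quasi-projective `S`, Hodge-symmetric Hodge models `A t`, a base
point `s` and every point `t₁` of `S(ℂ)`, arbitrarily small path-connected open neighbourhoods `W` of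
`t₁` inside a holomorphic chart `ψ` such that, for every admissible reference state `T₁` at `t₁`
(a rational transport from `s`) and every `p`, the `p`-th Hodge filtration step of `T^* H_t`, for the
continuations `T` of `T₁` inside `W`, is spanned by a linearly independent family of vectors of
`Hᵏ(X_s; ℚ) ⊗ ℂ` depending holomorphically on `t ∈ W` (read in the chart). Everything else — graded
frames adapted to the whole flag (`exists_holomorphicFrame_of_subbundleFrames`), the analytic
dichotomy of the Hodge loci, Deligne's generic point, André's type stability and the finiteness of
polarised integral classes of bounded norm — is proved in the tree.
[cite: BaldiKlinglerUllmo2024, §3.2] [cite: Deligne1972WeilK3, Prop. 7.5]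
[cite: VoisinHodgeI2002, Thm. 10.3] [cite: Griffiths1968PeriodsII] -/
theorem bku_finite_monodromyOrbit_of_isHodgeGenericIn_of_holomorphicHodgeSubbundles
    (hSub : ∀ [HodgeTensorFacts.{0, 0}] ⦃𝒳 S : SchemeOver ℂ⦄ (f : 𝒳 ⟶ S) (n k d : ℕ)
      (hf : IsSmoothProjectiveFamily f n) (_ : IsQuasiProjectiveOver S)
      [AlgebraicGeometry.SmoothOfRelativeDimension d S.hom]
      (hU : IsCohomologicallyLocallyTrivialOn f (Set.univ : Set (ComplexPoints S)))
      (A : ∀ t : ComplexPoints S, HodgeModel n (fiberOver f t)) (hA : ∀ t, (A t).IsHodgeSymmetric)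
      [∀ t, Module.Finite ℚ (singularCohomology ℚ ℚ (ComplexPoints (fiberOver f t)) k)]
      (s t₁ : (Set.univ : Set (ComplexPoints S))), ∀ N ∈ 𝓝 t₁,
      ∃ W : Set (Set.univ : Set (ComplexPoints S)), IsOpen W ∧ t₁ ∈ W ∧ W ⊆ N ∧ IsPathConnected W ∧
      ∃ (d' : ℕ) (ψ : OpenPartialHomeomorph (Set.univ : Set (ComplexPoints S)) (Fin d' → ℂ)),
        W ⊆ ψ.source ∧
      ∀ (T₁ : singularCohomology ℚ ℚ (ComplexPoints (fiberOver f s.1)) k ≃ₗ[ℚ]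
          singularCohomology ℚ ℚ (ComplexPoints (fiberOver f t₁.1)) k),
        (∃ δ₁ : Path.Homotopic.Quotient s t₁,
          ∀ v, ofRatClass _ k (T₁ v) = transportFun f k hU δ₁ (ofRatClass _ k v)) →
        ∀ p : ℤ, ∃ (r : ℕ)
          (w : Fin r → Set.Elem (Set.univ : Set (ComplexPoints S)) →
            ℂ ⊗[ℚ] singularCohomology ℚ ℚ (ComplexPoints (fiberOver f s.1)) k),
          (∀ t ∈ W, ∀ (ε : Path t₁ t), (∀ r', ε r' ∈ W) →
            ∀ (T : singularCohomology ℚ ℚ (ComplexPoints (fiberOver f s.1)) k ≃ₗ[ℚ]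
              singularCohomology ℚ ℚ (ComplexPoints (fiberOver f t.1)) k),
            (∀ v, ofRatClass _ k (T v) = transportFun f k hU ⟦ε⟧ (ofRatClass _ k (T₁ v))) →
            LinearIndependent ℂ (fun i ↦ w i t) ∧
              (((A t.1).hodgeStructure (hf.isSmoothProjective t.1) (hA t.1) k).comapEquiv T).F p =
                Submodule.span ℂ (Set.range fun i ↦ w i t)) ∧
          (∀ (i : Fin r)
            (φ : Module.Dual ℂ (ℂ ⊗[ℚ] singularCohomology ℚ ℚ (ComplexPoints (fiberOver f s.1)) k)),
            AnalyticOnNhd ℂ (fun z ↦ φ (w i (ψ.symm z))) (ψ '' W))) :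
    bku_finite_monodromyOrbit_of_isHodgeGenericIn := by
  refine bku_finite_monodromyOrbit_of_isHodgeGenericIn_of_holomorphicHodgeFrames ?_
  intro _ 𝒳 S f n k d hf hS _ hU A hA _ s t₁ N hN
  have h₁ := @hSub _ 𝒳 S f n k d hf hS _ hU A hA _ s t₁ N hN
  obtain ⟨W₀, hW₀o, ht₁W₀, hW₀N, hW₀pc, d', ψ, hW₀ψ, hfr⟩ := h₁
  -- topology of `S(ℂ)`: a manifold, hence locally path connected
  haveI : AlgebraicGeometry.LocallyOfFiniteType S.hom := hS.locallyOfFiniteType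
  haveI : AlgebraicGeometry.IsSeparated S.hom := hS.isVarietyPair_ofScheme.isSeparated
  haveI : T2Space (ComplexPoints S) := Literature.NumberTheory.Transcendental.t2Space_algPoints_holds _ ℂ
  letI := Motives.ComplexPoints.chartedSpace S d
  haveI : LocallyPathConnectedSpace (ComplexPoints S) :=
    ChartedSpace.locallyPathConnectedSpace (EuclideanSpace ℝ (Fin (2 * d))) _
  haveI : LocallyPathConnectedSpace (Set.univ : Set (ComplexPoints S)) :=
    isOpen_univ.locallyPathConnectedSpace
  have hrat : ∀ (x y : (Set.univ : Set (ComplexPoints S))) (γ : Path.Homotopic.Quotient x y)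
      (α : complexBetti (fiberOver f x.1) k), IsRationalClass α →
      IsRationalClass (transportFun f k hU γ α) :=
    fun x y γ α hα ↦ isRationalClass_transportFun_of_isSmoothProjectiveFamily f k d hf hS γ hα
  by_cases hjs : Joined s t₁
  · -- an admissible reference state at `t₁` exists: refine `W₀` by the frame construction
    obtain ⟨T₁, hT₁⟩ := exists_ratTransport f k hU hrat (⟦hjs.somePath⟧ : Path.Homotopic.Quotient s t₁)
    have hT₁' : ∃ δ₁ : Path.Homotopic.Quotient s t₁,
        ∀ v, ofRatClass _ k (T₁ v) = transportFun f k hU δ₁ (ofRatClass _ k v) := ⟨_, hT₁⟩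
    choose r w hw hwhol using hfr T₁ hT₁'
    obtain ⟨W, hWo, ht₁W, hWW₀, hWpc, hW⟩ := exists_holomorphicFrame_of_subbundleFrames f k hU s hrat
      (fun t ↦ (A t.1).hodgeStructure (hf.isSmoothProjective t.1) (hA t.1) k) hW₀o hW₀pc ψ hW₀ψ
      ht₁W₀ hT₁' r w hw hwhol
    exact ⟨W, hWo, ht₁W, hWW₀.trans hW₀N, hWpc, d', ψ, hWW₀.trans hW₀ψ, hW⟩
  · -- no admissible state near `t₁`: the frame condition is vacuous on `W₀`
    refine ⟨W₀, hW₀o, ht₁W₀, hW₀N, hW₀pc, d', ψ, hW₀ψ, fun x hx Tx hTx ↦ ?_⟩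
    exfalso
    obtain ⟨δ, -⟩ := hTx
    induction δ using Quotient.inductionOn with
    | h γ => exact hjs (Joined.trans ⟨γ⟩ (hW₀pc.joinedIn x hx t₁ ht₁W₀).joined)

end Subbundles

end HodgeTheory

end Literature.AlgebraicGeometry.HodgeTheory

end
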